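import Literature.MathematicalPhysics.QuantumFieldTheory.Balaban1983to89.B9Thm313WholeL2GP
import Literature.MathematicalPhysics.QuantumFieldTheory.Balaban1983to89.B9Thm313WholeInput

/-!
# `Balaban1983to89.B9Thm313WholeBlocksNbr` — [B9] Theorem 3.13 (p. 426): the L² BLOCK (3.46) and the HÖLDER BLOCK (3.43)–(3.45) of a kernel
# family CO-READ ON THE METRIC NEIGHBOURHOOD OF y (n06-k's `Nbr` species) by the models of 𝔊 = 𝔓G₁ = G₁𝔓*, at one member and one configuration,
# from the letters of (3.152)–(3.153) and the operator-level schemas — the second-order L² lines as direction-pair families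

T. Bałaban, *Propagators for lattice gauge theories in a background field*, Commun. Math. Phys. **99** (1985) 389–434
[`Balaban1985BackgroundPropagators`, "B9"]; [4] = T. Bałaban, *Propagators and renormalization transformations for lattice
gauge theories. II*, Commun. Math. Phys. **96** (1984) 223–250 [`Balaban1984PropagatorsII`].

statement-level skeleton of published theorems with citation tags; proofs where landed; nothing here is a claim about the
Yang–Mills mass gap

THE PRINTED LOCI are those of `…B9Thm313WholeLeafRelS` ∕ `…RelSH` ∕ `…LeafComplete`, `…B9Thm313WholeL2G(P)`, `…B9Thm313WholeHolder`,
`…B9Thm313WholeInput` (verbatim there): Theorem 3.13 p. 426, (3.152)–(3.153) p. 426, (3.42)–(3.46) pp. 397–398, (3.39) p. 397, Theorem 3.12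
p. 423, [4] (2.51)–(2.52) p. 232 and Lemma 2.1 p. 234.

WHY THIS FILE (the row-21 twin of `…B9Thm312WholeBlocksNbr`, same seat).  The row-21 leaves of this seat (`…LeafRelS` ∕ `…RelSH` ∕ `…RelSHL` ∕
`…LeafComplete`) read the (3.43)–(3.46) members of 𝔊's kernel family through n06-k's class-sited `L2ReadsRel` ∕ `H1ReadsRel` ∕ `InputReadsRel`, which
are NOT dischargeable at the record (located obstructions (O1)∕(O2), `B9RWSumsReadsRelNegative.not_l2ReadsRel_evBK`).  THIS FILE packages, at ONE
member and ONE configuration and with every uniformisation input explicit, the two typed blocks that `B9Thm313WholeLeafRel.thm313Printed_of_stepRel`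
displays as `hres`, in the NEIGHBOURHOOD-SITED species:
* ★ `GG_l2Block_nbr` — all six lines of (3.46) for a kernel family co-read (`L2ReadsNbr` ×6) by 𝔊, ∇_U𝔊, 𝔊∇\*_U, the pair family ∇_ν∇_μ𝔊, ∇_U𝔊∇\*_U and
  the pair family 𝔊∇\*_ν∇\*_μ: lines 0, 1, 2 by the Schur test from the PROVED sup majorants of (3.153) (`GG_entry0∕1∕2_of_letters`), line 4 by
  `B9Thm313WholeL2G.GG_l2bd_entry4`, lines 3∕5 by `B9Thm313WholeL2GP.GG_l2bd_family3∕5`, then `B9Thm312WholeBlocksNbr.l2Block_of_blockBds_nbr`;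
  conclusion `L2Block K (mN·m·Cev·CL²·e^{rδ}·K₆) δ U` for any K₆ above the member constants (hypotheses `hK6a hK6b hK6c`).
* ★ `GG_holder_nbr` — (3.43) from the two probe majorants `GG_probe43L∕R_of_letters` (co-reading `H1ReadsNbr`), (3.44)∕(3.45) from
  `GG_input44∕45_of_letters` (co-reading `InputReadsNbr`), then `ineq343_345_of_majorants_nbr`; the member constants are brought to expressions
  uniform along a family ((1 − θc)⁻¹ ≦ 2, θ′ ≦ t_D, θ_H ≦ t_H, θ_V ≦ t_V, Λ ≦ Λ_u, κ ≦ κ_u) inside, as in the class-sited leaf.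

HONEST SCOPE.  Nothing of [B9] or [4] is asserted: every schema, letter, reading and member fact is a HYPOTHESIS of printed ∕ definitional
shape; kernel-checked bookkeeping.  NOT a node discharge, NOT summit progress; one finite lattice at a time; nothing continuum, nothing about
the mass gap.  Cell `pub-ymgap` (HUMAN RULING D-0062), Track A node N06 [B9], N06-ASSIGNMENT v1 row 21 (bundle F7), seat `pub-ymgap-dag-n06-l`
(g5), 2026-08-27.
-/

namespace Literature.MathematicalPhysics.QuantumFieldTheory.Balaban1983to89.B9Thm313WholeBlocksNbr

open Literature.MathematicalPhysics.QuantumFieldTheory.Balaban1983to89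
open Finset B6RandomWalk B6RandomWalkHom B9Thm34Ext B9Thm37GlueCor36 B11SectG B9SectDSup
open B9Thm37AllNorms B9Thm37AllNormsInstances B9FromB6 B9SectBStepWhole B9Thm312Whole B9Thm312WholeLeaf
open B9Thm312WholeLeft B9Thm313Whole B9Thm313WholeLeft
open B9Thm37Glue B9SectDL2Decay B9RWSums343Holder B9RWSumsReadsRel B9RWSumsReadsNbr B9Ineq347 B9Thm312WholeClasses B9Thm312WholeL2
open B9Thm312WholeBlocksRel B9Thm312WholeBlocksNbr B9Thm312WholeHolder B9Thm312WholeHHolder B9Thm313WholeHolder B9Thm313WholeL2G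
open B9Thm313WholeL2GP B9Thm313WholeInput B9RWSums346SecondDiff

noncomputable section

section OneMember

variable {g : B9.Geometry} {B : B9.Backgrounds} {X Y Z W PX PY P : Type}
variable [Fintype X] [Fintype Y] [Fintype Z] [Fintype W] [Fintype PX] [Fintype PY] [Fintype P] [Fintype g.Site] [DecidableEq g.Site]
variable {R₀ : ℝ} {H₀ : Prop}

/-- ★ **THEOREM 3.13 — THE L² BLOCK (3.46) OF A KERNEL FAMILY CO-READ ON THE NEIGHBOURHOOD BY THE MODELS OF 𝔊 = 𝔓G₁, AT ONE MEMBER AND ONE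
CONFIGURATION.**  Data at U: Theorem 3.3 for G₀ (sup entries `he0 he2`, the derivative of the step `hLS`, the pair-indexed L² schema `hL2`), the
step on 𝔠⁽¹⁾, 𝔠⁽²⁾ (`hS1 hS2`) and in the L² class (`hT`), the letters of (3.152)–(3.153) (`hL hLD hLt`), the identities (`hI`), 𝔊 symmetric and
(∇_U𝔊)ᵀ = 𝔊∇\*_U, [4] Lemma 2.1 (row sum at σ; transfers at γ = 1, ½, −1 with constants below Λ_u ≧ 1), the co-readings `L2ReadsNbr` of `K.l2 0…5` by
𝔊, ∇_U𝔊, 𝔊∇\*_U, `familyOp (q ↦ ∇_{q.1}∇_{q.2}∘𝔊)`, ∇_U𝔊∇\*_U, `familyOp (q ↦ 𝔊∘∇\*_{q.1}∇\*_{q.2})`, the class and neighbourhood data; the member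
constants are dominated by explicit binders: C_sup above `const313 …` and `constD313 …` (lines 0–2), K_G above `constG46 (constKp B₂ B₄ θ₂′ c) c`
(lines 3–5), and K₆ above C_sup·Λ_u, K_G, √|P×P|·K_G·Λ_u.  Provisos: ρ′ + 3σ ≦ ρ, ρ′ + 5σ ≦ ρ ≦ δ₀, δ₃; ρ + σ ≦ δ_K; θc < 1; B₂θ₂′c² < 1; 0 ≦ δ ≦ (1 − α)ρ′,
δ ≦ ρ′.  Conclusion: `L2Block K (mN·m·Cev·CL²·e^{rδ}·K₆) δ U`.  Nothing of print asserted.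
[cite: Balaban1985BackgroundPropagators, Thm 3.13 p.426 + (3.152)–(3.153) p.426 + (3.46) p.398 + (3.39) p.397 + (3.42) p.397 + Thm 3.12 p.423 + p.391; Balaban1984PropagatorsII, (2.51)–(2.52) p.232 + Lemma 2.1 (2.60)–(2.61) p.234] -/
theorem GG_l2Block_nbr (hG : GeoOK g) {K : B9.KernelFamily g B} {𝔬 : Ops g B X Y Z W}
    {Dd Dds : B.Cfg → P → Module.End ℝ (X → ℝ)} {U : B.Cfg} {bH : BlockNorm (toB6 g R₀ H₀) (W → ℝ)}
    (Rel : g.Site → g.Site → Prop) [DecidableRel Rel] (ev : g.Loc → X → ℝ) (evY : g.Loc → Y → ℝ) {m mN : ℕ}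
    {r Cev CL θ θ' θ₂' B₀ B₂ B₃ B₄ δ₀ δ₃ δK ρ ρ' α σ c Csup KGu K6 Λ₁ Λh Λm Λu δ : ℝ}
    (hrow : RowSum (toB6 g R₀ H₀) σ c) (hc : 0 ≤ c) (hθ : 0 ≤ θ) (hθ' : 0 ≤ θ') (hθ₂' : 0 ≤ θ₂') (hB₀ : 0 ≤ B₀) (hB₂ : 0 ≤ B₂)
    (hB₃ : 0 ≤ B₃) (hB₄ : 0 ≤ B₄) (hσ : 0 ≤ σ) (hρ' : 0 < ρ') (hρ'ρ : ρ' + 3 * σ ≤ ρ) (hρ'ρ₅ : ρ' + 5 * σ ≤ ρ) (hρS : ρ ≤ δ₀)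
    (hρ₃ : ρ ≤ δ₃) (hρδ : ρ + σ ≤ δK) (hq1 : θ * c < 1) (hq₂1 : B₂ * θ₂' * c * c < 1) (hδ0 : 0 ≤ δ) (hδ1 : δ ≤ (1 - α) * ρ')
    (hδ2 : δ ≤ ρ')
    (hST1 : ScaleTransfer g ρ' α Λ₁ (fun y => g.len y ^ (1 : ℝ))) (hSTh : ScaleTransfer g ρ' α Λh (fun y => g.len y ^ (1 / 2 : ℝ)))
    (hSTm : ScaleTransfer g ρ' α Λm (fun y => g.len y ^ (-1 : ℝ))) (hΛ₁0 : 0 ≤ Λ₁) (hΛ₁le : Λ₁ ≤ Λu) (hΛhle : Λh ≤ Λu)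
    (hΛm0 : 0 ≤ Λm) (hΛmle : Λm ≤ Λu) (h1Λu : 1 ≤ Λu)
    (hCsup0 : 0 ≤ Csup) (hCle : const313 (B₀ * (1 - θ * c)⁻¹) (B₃ * (1 - θ * c)⁻¹) B₃ c ≤ Csup)
    (hDle : constD313 (B₀ + θ' * (B₀ * (1 - θ * c)⁻¹) * c) θ' (B₀ * (1 - θ * c)⁻¹) (B₃ * (1 - θ * c)⁻¹) B₃ bH.κ c ≤ Csup)
    (hKGu0 : 0 ≤ KGu) (hKGle : constG46 (constKp B₂ B₄ θ₂' c) c ≤ KGu) (hK60 : 0 ≤ K6) (hK6a : Csup * Λu ≤ K6) (hK6b : KGu ≤ K6)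
    (hK6c : Real.sqrt (Fintype.card (P × P)) * (KGu * Λu) ≤ K6)
    (hS1 : HasMaj (cNorm R₀ H₀ 𝔬.blk hG.lenle 1) (cNorm R₀ H₀ 𝔬.blk hG.lenle 1) (𝔬.G0 U ∘ₗ (𝔬.Tpi U + 𝔬.T2 U))
      (fun a b => θ * Real.exp (-(δK * g.dist a b))))
    (hS2 : HasMaj (cNorm R₀ H₀ 𝔬.blk hG.lenle 2) (cNorm R₀ H₀ 𝔬.blk hG.lenle 2) (𝔬.G0 U ∘ₗ (𝔬.Tpi U + 𝔬.T2 U))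
      (fun a b => θ * Real.exp (-(δK * g.dist a b))))
    (he0 : HasMajorant (g := toB6 g R₀ H₀) 𝔬.blk (𝔬.G0 U) (fun a b => B₀ * g.len a ^ 2 * Real.exp (-(δ₀ * g.dist a b))))
    (he2 : HasMajorantHom (g := toB6 g R₀ H₀) 𝔬.blkY 𝔬.blk (𝔬.G0 U ∘ₗ 𝔬.Dstar U)
      (fun a b => B₀ * g.len a * Real.exp (-(δ₀ * g.dist a b))))
    (hLS : LeftStep 𝔬 R₀ H₀ hG.lenle B₀ δ₀ θ' δK U)
    (hL : Letters313 𝔬 R₀ H₀ hG B₃ δ₃ U) (hLD : Letters313D 𝔬 R₀ H₀ hG B₃ δ₃ bH U) (hI : Identities 𝔬 U)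
    (hL2 : Thm33G0L2P 𝔬 Dd Dds R₀ H₀ B₂ ρ U)
    (hT : BlockBd (g := toB6 g R₀ H₀) 𝔬.blk 𝔬.blk (𝔬.Tpi U + 𝔬.T2 U)
      (fun (y y' : g.Site) => θ₂' * (g.len y)⁻¹ * (g.len y')⁻¹ * Real.exp (-(ρ * g.dist y y'))))
    (hLt : Letters313L2P 𝔬 Dd Dds R₀ H₀ B₄ ρ U)
    (hsym : IsTransposePair (𝔬.GG U) (𝔬.GG U)) (htr : IsTransposePair (𝔬.D U ∘ₗ 𝔬.GG U) (𝔬.GG U ∘ₗ 𝔬.Dstar U))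
    (hRd₂ : ∀ a b b', Rel b b' → g.dist a b = g.dist a b')
    (hmult : ∀ y' : g.Site, (Finset.univ.filter (fun y'' => Rel y'' y')).card ≤ m)
    (hnbr : ∀ y : g.Site, (nbr g r y).card ≤ mN)
    (hCL1 : 1 ≤ CL) (hCL : ∀ a a' : g.Site, g.dist a a' ≤ r → g.len a ≤ CL * g.len a') (hCev : 0 ≤ Cev)
    (hl0 : L2ReadsNbr (R := R₀) (H := H₀) K 0 U Rel r Cev 𝔬.blk 𝔬.blk ev (𝔬.GG U))
    (hl1 : L2ReadsNbr (R := R₀) (H := H₀) K 1 U Rel r Cev 𝔬.blkY 𝔬.blk ev (𝔬.D U ∘ₗ 𝔬.GG U))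
    (hl2 : L2ReadsNbr (R := R₀) (H := H₀) K 2 U Rel r Cev 𝔬.blk 𝔬.blkY evY (𝔬.GG U ∘ₗ 𝔬.Dstar U))
    (hl3 : L2ReadsNbr (R := R₀) (H := H₀) K 3 U Rel r Cev (𝔬.blk ∘ Prod.fst) 𝔬.blk ev
      (familyOp (fun q : P × P => (Dd U q.1 ∘ₗ Dd U q.2) ∘ₗ 𝔬.GG U)))
    (hl4 : L2ReadsNbr (R := R₀) (H := H₀) K 4 U Rel r Cev 𝔬.blkY 𝔬.blkY evY (𝔬.D U ∘ₗ (𝔬.GG U ∘ₗ 𝔬.Dstar U)))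
    (hl5 : L2ReadsNbr (R := R₀) (H := H₀) K 5 U Rel r Cev (𝔬.blk ∘ Prod.fst) 𝔬.blk ev
      (familyOp (fun q : P × P => 𝔬.GG U ∘ₗ (Dds U q.1 ∘ₗ Dds U q.2)))) :
    L2Block K (mN * m * Cev * CL ^ 2 * Real.exp (r * δ) * K6) δ U := by
  -- adapted from the bodies of `B9Thm313WholeLeafRelS.thm313Printed_of_stepRelS` (lines 0–2) and `B9Thm313WholeLeafComplete` (lines 3–5)
  set NP : ℝ := Real.sqrt (Fintype.card (P × P)) with hNP
  have hNP0 : 0 ≤ NP := Real.sqrt_nonneg _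
  have hq : θ * c ≤ 1 := hq1.le
  have hinv0 : 0 ≤ (1 - θ * c)⁻¹ := inv_nonneg.mpr (by linarith)
  have hA₁ : 0 ≤ B₀ * (1 - θ * c)⁻¹ := mul_nonneg hB₀ hinv0
  have hA₃ : 0 ≤ B₃ * (1 - θ * c)⁻¹ := mul_nonneg hB₃ hinv0
  have hC0 : 0 ≤ const313 (B₀ * (1 - θ * c)⁻¹) (B₃ * (1 - θ * c)⁻¹) B₃ c := const313_nonneg hA₁ hA₃ hB₃ hc
  have hlen := hG.lenle
  have hΛu0 : 0 ≤ Λu := zero_le_one.trans h1Λu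
  -- the model majorants of 𝔊 at the rate ρ′ (sup entries of (3.153), proved upstream)
  have hm0 := GG_entry0_of_letters hG hrow hc hθ hB₀ hB₃ hσ hρ'.le hρ'ρ hρS hρ₃ hρδ hq1 hS2 he0 hL hI
  have hm1 := GG_entry1_of_letters hG hrow hc hθ hθ' hB₀ hB₃ hσ hρ'.le hρ'ρ hρS hρ₃ hρδ hq1 hS2 he0 hLS hL hLD hI
  have hm2 := GG_entry2_of_letters hG hrow hc hθ hB₀ hB₃ hσ hρ'.le hρ'ρ hρS hρ₃ hρδ hq1 hS1 he2 hL hI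
  -- lines 0, 1, 2 by the Schur test and the scale transfer
  have hb0 := l2bd_entry0_of_sup (R₀ := R₀) (H₀ := H₀) hG hC0 hST1 hm0 hsym
  have hm1' : HasMajorantHom (g := toB6 g R₀ H₀) 𝔬.blk 𝔬.blkY (𝔬.D U ∘ₗ 𝔬.GG U)
      (fun (a b : g.Site) => Csup * g.len a * Real.exp (-(ρ' * g.dist a b))) :=
    hasMajorantHom_mono (g := toB6 g R₀ H₀) 𝔬.blk 𝔬.blkY hm1 fun a b =>
      mul_le_mul_of_nonneg_right (mul_le_mul_of_nonneg_right hDle (hlen a)) (Real.exp_nonneg _)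
  have hm2' : HasMajorantHom (g := toB6 g R₀ H₀) 𝔬.blkY 𝔬.blk (𝔬.GG U ∘ₗ 𝔬.Dstar U)
      (fun (a b : g.Site) => Csup * g.len a * Real.exp (-(ρ' * g.dist a b))) :=
    hasMajorantHom_mono (g := toB6 g R₀ H₀) 𝔬.blkY 𝔬.blk hm2 fun a b =>
      mul_le_mul_of_nonneg_right (mul_le_mul_of_nonneg_right hCle (hlen a)) (Real.exp_nonneg _)
  obtain ⟨hb1, hb2⟩ := l2bd_entry12_of_sup (R₀ := R₀) (H₀ := H₀) hG hCsup0 hSTh hm1' hm2' htr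
  -- lines 3, 4, 5 from the pair schemas (line 4 through the Laplacian-free projections)
  have hb4 := GG_l2bd_entry4 hG hrow hB₂ hB₄ hθ₂' hρ'.le hσ hρ'ρ₅ (Thm33G0L2P.toLap hB₂ hG.lenle hL2) hT
    (Letters313L2P.toLap hB₄ hG.lenle hLt) hI hq₂1
  have hb3 := GG_l2bd_family3 hG hrow hB₂ hB₄ hθ₂' hρ'.le hσ hρ'ρ₅ hΛ₁0 hST1 hL2 hT hLt hI hq₂1
  have hb5 := GG_l2bd_family5 hG hrow hB₂ hB₄ hθ₂' hρ'.le hσ hρ'ρ₅ hΛm0 hSTm hL2 hT hLt hI hq₂1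
  have hρα : ρ' - α * ρ' = (1 - α) * ρ' := by ring
  rw [hρα] at hb3 hb5
  -- the member constants below K₆ and the rates above δ
  have hS0 : 0 ≤ B₂ + B₄ := add_nonneg hB₂ hB₄
  have hKp0 : 0 ≤ constKp B₂ B₄ θ₂' c := (constP_nonneg_le hθ₂' hc hq₂1 hS0 hS0 hS0 le_rfl le_rfl le_rfl).1
  have hKG0 : 0 ≤ constG46 (constKp B₂ B₄ θ₂' c) c := constG46_nonneg hKp0 hc
  have hK0le : const313 (B₀ * (1 - θ * c)⁻¹) (B₃ * (1 - θ * c)⁻¹) B₃ c * Λ₁ ≤ K6 :=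
    (mul_le_mul hCle hΛ₁le hΛ₁0 hCsup0).trans hK6a
  have hKhle : Csup * Λh ≤ K6 := (mul_le_mul_of_nonneg_left hΛhle hCsup0).trans hK6a
  have hK4le : constG46 (constKp B₂ B₄ θ₂' c) c ≤ K6 := hKGle.trans hK6b
  have hK3le : NP * (constG46 (constKp B₂ B₄ θ₂' c) c * Λ₁) ≤ K6 :=
    (mul_le_mul_of_nonneg_left (mul_le_mul hKGle hΛ₁le hΛ₁0 hKGu0) hNP0).trans hK6c
  have hK5le : NP * (constG46 (constKp B₂ B₄ θ₂' c) c * Λm) ≤ K6 :=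
    (mul_le_mul_of_nonneg_left (mul_le_mul hKGle hΛmle hΛm0 hKGu0) hNP0).trans hK6c
  have hexp : ∀ {r₁ : ℝ}, δ ≤ r₁ → ∀ y y' : g.Site, Real.exp (-(r₁ * g.dist y y')) ≤ Real.exp (-(δ * g.dist y y')) :=
    fun h y y' => Real.exp_le_exp.mpr (neg_le_neg (mul_le_mul_of_nonneg_right h (hG.dnn y y')))
  have hP : ∀ t : ℝ, B9.pref6 t 0 = t ^ 2 ∧ B9.pref6 t 1 = t ∧ B9.pref6 t 2 = t ∧ B9.pref6 t 3 = 1 ∧ B9.pref6 t 4 = 1 ∧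
      B9.pref6 t 5 = 1 := fun t => by simp [B9.pref6]
  have hB0 : BlockBd (g := toB6 g R₀ H₀) 𝔬.blk 𝔬.blk (𝔬.GG U)
      (fun (y y' : g.Site) => K6 * B9.pref6 (g.len y) 0 * Real.exp (-(δ * g.dist y y'))) := by
    refine hb0.mono fun y y' => ?_
    rw [(hP (g.len y)).1]
    calc const313 (B₀ * (1 - θ * c)⁻¹) (B₃ * (1 - θ * c)⁻¹) B₃ c * Λ₁ * g.len y ^ 2 * Real.exp (-((1 - α) * ρ' * g.dist y y'))
        ≤ K6 * g.len y ^ 2 * Real.exp (-((1 - α) * ρ' * g.dist y y')) :=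
          mul_le_mul_of_nonneg_right (mul_le_mul_of_nonneg_right hK0le (sq_nonneg _)) (Real.exp_nonneg _)
      _ ≤ K6 * g.len y ^ 2 * Real.exp (-(δ * g.dist y y')) := mul_le_mul_of_nonneg_left (hexp hδ1 y y') (mul_nonneg hK60 (sq_nonneg _))
  have hB1 : BlockBd (g := toB6 g R₀ H₀) 𝔬.blk 𝔬.blkY (𝔬.D U ∘ₗ 𝔬.GG U)
      (fun (y y' : g.Site) => K6 * B9.pref6 (g.len y) 1 * Real.exp (-(δ * g.dist y y'))) := by
    refine hb1.mono fun y y' => ?_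
    rw [(hP (g.len y)).2.1]
    calc Csup * Λh * g.len y * Real.exp (-((1 - α) * ρ' * g.dist y y'))
        ≤ K6 * g.len y * Real.exp (-((1 - α) * ρ' * g.dist y y')) :=
          mul_le_mul_of_nonneg_right (mul_le_mul_of_nonneg_right hKhle (hlen y)) (Real.exp_nonneg _)
      _ ≤ K6 * g.len y * Real.exp (-(δ * g.dist y y')) := mul_le_mul_of_nonneg_left (hexp hδ1 y y') (mul_nonneg hK60 (hlen y))
  have hB2 : BlockBd (g := toB6 g R₀ H₀) 𝔬.blkY 𝔬.blk (𝔬.GG U ∘ₗ 𝔬.Dstar U)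
      (fun (y y' : g.Site) => K6 * B9.pref6 (g.len y) 2 * Real.exp (-(δ * g.dist y y'))) := by
    refine hb2.mono fun y y' => ?_
    rw [(hP (g.len y)).2.2.1]
    calc Csup * Λh * g.len y * Real.exp (-((1 - α) * ρ' * g.dist y y'))
        ≤ K6 * g.len y * Real.exp (-((1 - α) * ρ' * g.dist y y')) :=
          mul_le_mul_of_nonneg_right (mul_le_mul_of_nonneg_right hKhle (hlen y)) (Real.exp_nonneg _)
      _ ≤ K6 * g.len y * Real.exp (-(δ * g.dist y y')) := mul_le_mul_of_nonneg_left (hexp hδ1 y y') (mul_nonneg hK60 (hlen y))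
  have hB3 : BlockBd (g := toB6 g R₀ H₀) 𝔬.blk (𝔬.blk ∘ Prod.fst) (familyOp (fun q : P × P => (Dd U q.1 ∘ₗ Dd U q.2) ∘ₗ 𝔬.GG U))
      (fun (y y' : g.Site) => K6 * B9.pref6 (g.len y) 3 * Real.exp (-(δ * g.dist y y'))) := by
    refine hb3.mono fun y y' => ?_
    rw [(hP (g.len y)).2.2.2.1, mul_one]
    calc NP * (constG46 (constKp B₂ B₄ θ₂' c) c * Λ₁ * Real.exp (-((1 - α) * ρ' * g.dist y y')))
        = NP * (constG46 (constKp B₂ B₄ θ₂' c) c * Λ₁) * Real.exp (-((1 - α) * ρ' * g.dist y y')) := by ring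
      _ ≤ K6 * Real.exp (-(δ * g.dist y y')) := mul_le_mul hK3le (hexp hδ1 y y') (Real.exp_nonneg _) hK60
  have hB4 : BlockBd (g := toB6 g R₀ H₀) 𝔬.blkY 𝔬.blkY (𝔬.D U ∘ₗ (𝔬.GG U ∘ₗ 𝔬.Dstar U))
      (fun (y y' : g.Site) => K6 * B9.pref6 (g.len y) 4 * Real.exp (-(δ * g.dist y y'))) := by
    refine hb4.mono fun y y' => ?_
    rw [(hP (g.len y)).2.2.2.2.1, mul_one]
    exact mul_le_mul hK4le (hexp hδ2 y y') (Real.exp_nonneg _) hK60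
  have hB5 : BlockBd (g := toB6 g R₀ H₀) 𝔬.blk (𝔬.blk ∘ Prod.fst) (familyOp (fun q : P × P => 𝔬.GG U ∘ₗ (Dds U q.1 ∘ₗ Dds U q.2)))
      (fun (y y' : g.Site) => K6 * B9.pref6 (g.len y) 5 * Real.exp (-(δ * g.dist y y'))) := by
    refine hb5.mono fun y y' => ?_
    rw [(hP (g.len y)).2.2.2.2.2, mul_one]
    calc NP * (constG46 (constKp B₂ B₄ θ₂' c) c * Λm * Real.exp (-((1 - α) * ρ' * g.dist y y')))
        = NP * (constG46 (constKp B₂ B₄ θ₂' c) c * Λm) * Real.exp (-((1 - α) * ρ' * g.dist y y')) := by ring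
      _ ≤ K6 * Real.exp (-(δ * g.dist y y')) := mul_le_mul hK5le (hexp hδ1 y y') (Real.exp_nonneg _) hK60
  exact l2Block_of_blockBds_nbr (R := R₀) (H := H₀) hG hRd₂ hmult hnbr hCL1 hCL hCev hK60 hδ0 hB0 hB1 hB2 hB3 hB4 hB5
    hl0 hl1 hl2 hl3 hl4 hl5

omit [Fintype Z] [Fintype P] in
/-- the polynomial of `constI44` is monotone in (A₁, A₃, θ′, θ_H, θ_v, Λ, κ) for non-negative data (from the class-sited leaf).
[cite: Balaban1985BackgroundPropagators, Thm 3.13 p.426 (bookkeeping)] -/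
private theorem polyI44_le' {Bi Bd B₀ B₃ Br c A₁ A₁' A₃ A₃' t' T' tH TH tv TV Λ Λ' κ κ' : ℝ} (hBd : 0 ≤ Bd) (hB₀ : 0 ≤ B₀)
    (hB₃ : 0 ≤ B₃) (hBr : 0 ≤ Br) (hc : 0 ≤ c) (hA₁ : 0 ≤ A₁) (hA₁' : A₁ ≤ A₁') (hA₃ : 0 ≤ A₃) (hA₃' : A₃ ≤ A₃') (ht' : 0 ≤ t')
    (hT' : t' ≤ T') (htH : 0 ≤ tH) (hTH : tH ≤ TH) (htv : 0 ≤ tv) (hTV : tv ≤ TV) (hΛ : 0 ≤ Λ) (hΛ' : Λ ≤ Λ') (hκ : 0 ≤ κ)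
    (hκ' : κ ≤ κ') :
    (Bi + (B₀ + t' * A₁ * c) * Λ * tH * c) + κ * (Bd + (B₀ + t' * A₁ * c) * Λ * tv * c) * Br * c +
        (B₃ + t' * A₃ * c) * Λ * (B₃ * (B₃ * A₁ * c) * c) * c ≤
      (Bi + (B₀ + T' * A₁' * c) * Λ' * TH * c) + κ' * (Bd + (B₀ + T' * A₁' * c) * Λ' * TV * c) * Br * c +
        (B₃ + T' * A₃' * c) * Λ' * (B₃ * (B₃ * A₁' * c) * c) * c := by
  have hA₁'0 : 0 ≤ A₁' := hA₁.trans hA₁'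
  have hA₃'0 : 0 ≤ A₃' := hA₃.trans hA₃'
  have hT'0 : 0 ≤ T' := ht'.trans hT'
  have hTH0 : 0 ≤ TH := htH.trans hTH
  have hTV0 : 0 ≤ TV := htv.trans hTV
  have hΛ'0 : 0 ≤ Λ' := hΛ.trans hΛ'
  have hκ'0 : 0 ≤ κ' := hκ.trans hκ'
  have h1 : (B₀ + t' * A₁ * c) * Λ * tH * c ≤ (B₀ + T' * A₁' * c) * Λ' * TH * c := by gcongr
  have h2 : κ * (Bd + (B₀ + t' * A₁ * c) * Λ * tv * c) * Br * c ≤ κ' * (Bd + (B₀ + T' * A₁' * c) * Λ' * TV * c) * Br * c := by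
    gcongr
  have h3 : (B₃ + t' * A₃ * c) * Λ * (B₃ * (B₃ * A₁ * c) * c) * c ≤ (B₃ + T' * A₃' * c) * Λ' * (B₃ * (B₃ * A₁' * c) * c) * c := by
    gcongr
  linarith

omit [Fintype Z] [Fintype P] in
/-- the polynomial of `constI45` is monotone in (A₁, A₃, θ_H, θ_v, Λ, κ) for non-negative data (from the class-sited leaf).
[cite: Balaban1985BackgroundPropagators, Thm 3.13 p.426 (bookkeeping)] -/
private theorem polyI45_le' {Bi2 Bd2 Bh Bq B₀ B₃ Br c A₁ A₁' A₃ A₃' tH TH tv TV Λ Λ' κ κ' : ℝ} (hBd2 : 0 ≤ Bd2) (hBh : 0 ≤ Bh)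
    (hBq : 0 ≤ Bq) (hB₃ : 0 ≤ B₃) (hBr : 0 ≤ Br) (hc : 0 ≤ c) (hA₁ : 0 ≤ A₁) (hA₁' : A₁ ≤ A₁') (hA₃ : 0 ≤ A₃) (hA₃' : A₃ ≤ A₃')
    (htH : 0 ≤ tH) (hTH : tH ≤ TH) (htv : 0 ≤ tv) (hTV : tv ≤ TV) (hΛ : 0 ≤ Λ) (hΛ' : Λ ≤ Λ') (hκ : 0 ≤ κ) (hκ' : κ ≤ κ')
    (_hB₀ : 0 ≤ B₀) :
    (Bi2 + (Bh + tH * A₁ * c) * Λ * tH * c) + κ * (Bd2 + (Bh + tH * A₁ * c) * Λ * tv * c) * Br * c +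
        (Bq + tH * A₃ * c) * Λ * (B₃ * (B₃ * A₁ * c) * c) * c ≤
      (Bi2 + (Bh + TH * A₁' * c) * Λ' * TH * c) + κ' * (Bd2 + (Bh + TH * A₁' * c) * Λ' * TV * c) * Br * c +
        (Bq + TH * A₃' * c) * Λ' * (B₃ * (B₃ * A₁' * c) * c) * c := by
  have hA₁'0 : 0 ≤ A₁' := hA₁.trans hA₁'
  have hA₃'0 : 0 ≤ A₃' := hA₃.trans hA₃'
  have hTH0 : 0 ≤ TH := htH.trans hTH
  have hTV0 : 0 ≤ TV := htv.trans hTV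
  have hΛ'0 : 0 ≤ Λ' := hΛ.trans hΛ'
  have hκ'0 : 0 ≤ κ' := hκ.trans hκ'
  have h1 : (Bh + tH * A₁ * c) * Λ * tH * c ≤ (Bh + TH * A₁' * c) * Λ' * TH * c := by gcongr
  have h2 : κ * (Bd2 + (Bh + tH * A₁ * c) * Λ * tv * c) * Br * c ≤ κ' * (Bd2 + (Bh + TH * A₁' * c) * Λ' * TV * c) * Br * c := by
    gcongr
  have h3 : (Bq + tH * A₃ * c) * Λ * (B₃ * (B₃ * A₁ * c) * c) * c ≤ (Bq + TH * A₃' * c) * Λ' * (B₃ * (B₃ * A₁' * c) * c) * c := by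
    gcongr
  linarith

omit [Fintype Z] [Fintype P] in
/-- `constH313` is monotone in every constant but B₃, c (for non-negative data) (from the class-sited leaf).
[cite: Balaban1985BackgroundPropagators, Thm 3.13 p.426 (bookkeeping)] -/
private theorem constH313_mono₄ {CL CL' θ' θ'' A₁ A₁' A₃ A₃' B₃ Bd Bd' Bq Bq' κW κW' c : ℝ} (hL' : CL ≤ CL') (hθ : 0 ≤ θ')
    (hθ'' : θ' ≤ θ'') (h₁ : 0 ≤ A₁) (h₁' : A₁ ≤ A₁') (h₃ : 0 ≤ A₃) (h₃' : A₃ ≤ A₃') (hB : 0 ≤ B₃) (hd : 0 ≤ Bd) (hd' : Bd ≤ Bd')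
    (hq : 0 ≤ Bq) (hq' : Bq ≤ Bq') (hκ : 0 ≤ κW) (hκ' : κW ≤ κW') (hc : 0 ≤ c) :
    constH313 CL θ' A₁ A₃ B₃ Bd Bq κW c ≤ constH313 CL' θ'' A₁' A₃' B₃ Bd' Bq' κW' c := by
  unfold constH313
  have hθ''0 : 0 ≤ θ'' := hθ.trans hθ''
  have hA₃'0 : 0 ≤ A₃' := h₃.trans h₃'
  have hd'0 : 0 ≤ Bd' := hd.trans hd'
  have hκ'0 : 0 ≤ κW' := hκ.trans hκ'
  have hq'0 : 0 ≤ Bq' := hq.trans hq'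
  have e2 : κW * Bd * B₃ * c ≤ κW' * Bd' * B₃ * c := by gcongr
  have e3 : θ' * (A₃ * B₃ * c) * c ≤ θ'' * (A₃' * B₃ * c) * c := by gcongr
  have e4 : Bq * (B₃ * (B₃ * A₁ * c) * c) * c ≤ Bq' * (B₃ * (B₃ * A₁' * c) * c) * c := by gcongr
  have e5 : θ' * (A₃ * (B₃ * (B₃ * A₁ * c) * c) * c) * c ≤ θ'' * (A₃' * (B₃ * (B₃ * A₁' * c) * c) * c) * c := by gcongr
  linarith

omit [Fintype P] in
/-- ★ **THEOREM 3.13 — THE HÖLDER BLOCK (3.43)–(3.45) OF A KERNEL FAMILY CO-READ ON THE NEIGHBOURHOOD BY THE MODELS OF 𝔊 = 𝔓G₁, AT ONE MEMBER AND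
ONE CONFIGURATION.**  (3.43) from the two probe majorants of (3.153) (`GG_probe43L∕R_of_letters`: Theorem 3.3's probes for G₀, the Hölder step,
the letters `LettersHH.pQ`, `Letters313H`, `Letters313D.rgdH`) read through `H1ReadsNbr`; (3.44)∕(3.45) from `GG_input44∕45_of_letters` (the input
letters `Letters313I`, the input step, Theorem 3.3's input members) read through `InputReadsNbr`; the member constants brought to the family-uniform
expressions ((1 − θc)⁻¹ ≦ 2, θ′ ≦ t_D, θ_H′ ≦ t_H, θ_V′ ≦ t_V, Λ ≦ Λ_u, κ ≦ κ_u), then `B9Thm312WholeBlocksNbr.ineq343_345_of_majorants_nbr` at the rate ρ₄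
(ρ₄ + 3σ ≦ (1 − α)ρ′): `B9.Ineq343_345 K (m·CL·e^{rρ₄}·C_u) (e^{rρ₄}·C₄₄) (CL·e^{rρ₄}·C₄₅) ρ₄ U`.  Nothing of print asserted.
[cite: Balaban1985BackgroundPropagators, Thm 3.13 p.426 + (3.152)–(3.153) p.426 + (3.43)–(3.45) p.398 + (3.40) p.397 + Thm 3.12 p.423; Balaban1984PropagatorsII, (2.51)–(2.52) p.232 + Lemma 2.1 (2.60)–(2.61) p.234] -/
theorem GG_holder_nbr (hG : GeoOK g) (𝔭 : HolderProbes g B X Y PX PY) (K : B9.KernelFamily g B) {𝔬 : Ops g B X Y Z W} {U : B.Cfg}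
    {bHY : ℝ → BlockNorm (toB6 g R₀ H₀) (Y → ℝ)} {bHW : ℝ → BlockNorm (toB6 g R₀ H₀) (W → ℝ)} {bH : BlockNorm (toB6 g R₀ H₀) (W → ℝ)}
    (Rel : g.Site → g.Site → Prop) [DecidableRel Rel] {ev : g.Loc → X → ℝ} {evY : g.Loc → Y → ℝ} {m : ℕ}
    {r CL θ θ' θH' θv' tD tH tV B₀ B₃ Br Λ Λu κu ρ ρ' ρ₄ α σ c δ₀ δ₃ δK : ℝ} {Bh Bi Bq Bd BhD Bx : ℝ → ℝ} {Bi2 Bd2 : ℝ → ℝ → ℝ}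
    (hrow : RowSum (toB6 g R₀ H₀) σ c) (hc : 0 ≤ c) (hθ : 0 ≤ θ) (hθ' : 0 ≤ θ') (hθH' : 0 ≤ θH') (hθv' : 0 ≤ θv')
    (hθ'le : θ' ≤ tD) (hθH'le : θH' ≤ tH) (hθv'le : θv' ≤ tV) (hB₀ : 0 ≤ B₀) (hB₃ : 0 ≤ B₃) (hBr : 0 ≤ Br) (hq : θ * c ≤ 1 / 2)
    (hBh : ∀ β, 0 ≤ β → β < 1 → 0 ≤ Bh β) (hBi : ∀ ε, 0 < ε → ε ≤ 1 → 0 ≤ Bi ε) (hBq : ∀ β, 0 ≤ β → β < 1 → 0 ≤ Bq β)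
    (hBd : ∀ ε, 0 < ε → ε ≤ 1 → 0 ≤ Bd ε) (hBi2 : ∀ ε β, 0 < ε → ε ≤ 1 → 0 ≤ β → β < 1 → 0 ≤ Bi2 ε β)
    (hBd2 : ∀ ε β, 0 < ε → ε ≤ 1 → 0 ≤ β → β < 1 → 0 ≤ Bd2 ε β) (hBhD : ∀ β, 0 ≤ β → β < 1 → 0 ≤ BhD β)
    (hBx : ∀ β, 0 ≤ β → β < 1 → 0 ≤ Bx β) (hΛ0 : 0 ≤ Λ) (hΛle : Λ ≤ Λu)
    (hκ : bH.κ ≤ κu) (hκW : ∀ ε, (bHW ε).κ ≤ κu) (h1κ : 1 ≤ κu) (hα0 : 0 ≤ α) (hσ : 0 ≤ σ) (hρ' : 0 < ρ') (hρ'ρ : ρ' + 3 * σ ≤ ρ)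
    (hρ₄0 : 0 ≤ ρ₄) (hρ₄r : ρ₄ + 3 * σ ≤ (1 - α) * ρ') (hρS : ρ ≤ δ₀) (hρ₃ : ρ ≤ δ₃) (hρδ : ρ + σ ≤ δK)
    (hρ'0 : ρ' ≤ δ₀) (hρ'₃ : ρ' ≤ δ₃) (hρ'K : ρ' + σ ≤ δK) (hST : ScaleTransfer g ρ' α Λ (fun y => g.len y ^ (1 : ℝ)))
    (he0 : HasMajorant (g := toB6 g R₀ H₀) 𝔬.blk (𝔬.G0 U) (fun a b => B₀ * g.len a ^ 2 * Real.exp (-(δ₀ * g.dist a b))))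
    (he2 : HasMajorantHom (g := toB6 g R₀ H₀) 𝔬.blkY 𝔬.blk (𝔬.G0 U ∘ₗ 𝔬.Dstar U)
      (fun (a b : g.Site) => B₀ * g.len a * Real.exp (-(δ₀ * g.dist a b))))
    (hK1 : HasMaj (cNorm R₀ H₀ 𝔬.blk hG.lenle 1) (cNorm R₀ H₀ 𝔬.blk hG.lenle 1) (𝔬.G0 U ∘ₗ (𝔬.Tpi U + 𝔬.T2 U))
      (fun a b => θ * Real.exp (-(δK * g.dist a b))))
    (hK2 : HasMaj (cNorm R₀ H₀ 𝔬.blk hG.lenle 2) (cNorm R₀ H₀ 𝔬.blk hG.lenle 2) (𝔬.G0 U ∘ₗ (𝔬.Tpi U + 𝔬.T2 U))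
      (fun a b => θ * Real.exp (-(δK * g.dist a b))))
    (hLS : LeftStep 𝔬 R₀ H₀ hG.lenle B₀ δ₀ θ' δK U) (hH0 : Thm33G0H 𝔬 𝔭 R₀ H₀ bHY Bh Bi Bi2 δ₀ U)
    (hStH : StepH 𝔬 𝔭 R₀ H₀ bHY hG.lenle θH' δK U) (hHH : LettersHH 𝔬 𝔭 R₀ H₀ hG.lenle Bq δ₃ U)
    (hH3 : Letters313H 𝔬 𝔭 R₀ H₀ hG.lenle bH BhD Bx δ₃ U)
    (hL : Letters313 𝔬 R₀ H₀ hG B₃ δ₃ U) (hLD : Letters313D 𝔬 R₀ H₀ hG B₃ δ₃ bH U)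
    (hLI : Letters313I 𝔬 𝔭 R₀ H₀ hG.lenle bHY bHW Br θv' Bd Bd2 δ₃ δK U) (hI : Identities 𝔬 U)
    (hRd₂ : ∀ a b b', Rel b b' → g.dist a b = g.dist a b')
    (hmult : ∀ y' : g.Site, (Finset.univ.filter (fun y'' => Rel y'' y')).card ≤ m)
    (hCL1 : 1 ≤ CL) (hCL : ∀ a a' : g.Site, g.dist a a' ≤ r → g.len a ≤ CL * g.len a')
    (hH1 : H1ReadsNbr K U 𝔭 Rel r 𝔬.blk 𝔬.blkY ev evY (𝔬.D U ∘ₗ 𝔬.GG U) (𝔬.GG U ∘ₗ 𝔬.Dstar U))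
    (hIn : InputReadsNbr K U 𝔭 bHY r 𝔬.blkY evY (𝔬.D U ∘ₗ (𝔬.GG U ∘ₗ 𝔬.Dstar U))) :
    B9.Ineq343_345 K
      (fun β => m * CL * Real.exp (r * ρ₄) *
        constH313 (Bh β + tH * (2 * B₀) * c) tH (2 * B₀) (2 * B₃) B₃ (max (BhD β) (Bx β)) (max (Bq β) (Bx β)) κu c)
      (fun ε => Real.exp (r * ρ₄) * ((Bi ε + (B₀ + tD * (2 * B₀) * c) * Λu * tH * c) +
        κu * (Bd ε + (B₀ + tD * (2 * B₀) * c) * Λu * tV * c) * Br * c +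
        (B₃ + tD * (2 * B₃) * c) * Λu * (B₃ * (B₃ * (2 * B₀) * c) * c) * c))
      (fun ε β => CL * Real.exp (r * ρ₄) * ((Bi2 ε β + (Bh β + tH * (2 * B₀) * c) * Λu * tH * c) +
        κu * (Bd2 ε β + (Bh β + tH * (2 * B₀) * c) * Λu * tV * c) * Br * c +
        (Bq β + tH * (2 * B₃) * c) * Λu * (B₃ * (B₃ * (2 * B₀) * c) * c) * c)) ρ₄ U := by
  -- adapted from `B9Thm313WholeLeafRelSH` ((3.43)) and `B9Thm313WholeLeafComplete.lines4445_GG` ((3.44)∕(3.45)), Nbr engines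
  have hq1 : θ * c < 1 := lt_one_of_le_half hq
  have hinv0 : 0 ≤ (1 - θ * c)⁻¹ := inv_nonneg.mpr (by linarith)
  have hA₁ : 0 ≤ B₀ * (1 - θ * c)⁻¹ := mul_nonneg hB₀ hinv0
  have hA₃ : 0 ≤ B₃ * (1 - θ * c)⁻¹ := mul_nonneg hB₃ hinv0
  have hA₁le : B₀ * (1 - θ * c)⁻¹ ≤ 2 * B₀ := const_le_two_mul hB₀ hq
  have hA₃le : B₃ * (1 - θ * c)⁻¹ ≤ 2 * B₃ := const_le_two_mul hB₃ hq
  have hκu0 : 0 ≤ κu := zero_le_one.trans h1κ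
  have htD0 : 0 ≤ tD := hθ'.trans hθ'le
  have htH0 : 0 ≤ tH := hθH'.trans hθH'le
  have htV0 : 0 ≤ tV := hθv'.trans hθv'le
  have hΛu0 : 0 ≤ Λu := hΛ0.trans hΛle
  have h2B₀ : 0 ≤ 2 * B₀ := mul_nonneg zero_le_two hB₀
  have h2B₃ : 0 ≤ 2 * B₃ := mul_nonneg zero_le_two hB₃
  have hlen := hG.lenle
  have hρ₄ρ' : ρ₄ ≤ ρ' := by
    have h1 : (1 - α) * ρ' = ρ' - α * ρ' := by ring
    linarith [mul_nonneg hα0 hρ'.le]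
  have hexp : ∀ a b : g.Site, Real.exp (-(ρ' * g.dist a b)) ≤ Real.exp (-(ρ₄ * g.dist a b)) := fun a b =>
    Real.exp_le_exp.mpr (neg_le_neg (mul_le_mul_of_nonneg_right hρ₄ρ' (hG.dnn a b)))
  -- the (3.43) constant, uniformised
  set Cu : ℝ → ℝ := fun β => constH313 (Bh β + tH * (2 * B₀) * c) tH (2 * B₀) (2 * B₃) B₃ (max (BhD β) (Bx β)) (max (Bq β) (Bx β))
    κu c with hCu
  have hCuL : ∀ β, 0 ≤ β → β < 1 →
      constH313 (Bh β + θH' * (B₀ * (1 - θ * c)⁻¹) * c) θH' (B₀ * (1 - θ * c)⁻¹) (B₃ * (1 - θ * c)⁻¹) B₃ (BhD β) (Bq β) bH.κ c ≤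
        Cu β := by
    intro β h0 h1
    have hCL' : Bh β + θH' * (B₀ * (1 - θ * c)⁻¹) * c ≤ Bh β + tH * (2 * B₀) * c := by
      have := mul_le_mul_of_nonneg_right (mul_le_mul hθH'le hA₁le hA₁ htH0) hc; linarith
    exact constH313_mono₄ hCL' hθH' hθH'le hA₁ hA₁le hA₃ hA₃le hB₃ (hBhD β h0 h1) (le_max_left _ _) (hBq β h0 h1) (le_max_left _ _)
      bH.κ_nonneg hκ hc
  have hCuR : ∀ β, 0 ≤ β → β < 1 →
      constH313 (Bh β + θH' * (B₀ * (1 - θ * c)⁻¹) * c) θH' (B₀ * (1 - θ * c)⁻¹) (B₃ * (1 - θ * c)⁻¹) B₃ (Bx β) (Bx β) 1 c ≤ Cu β := by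
    intro β h0 h1
    have hCL' : Bh β + θH' * (B₀ * (1 - θ * c)⁻¹) * c ≤ Bh β + tH * (2 * B₀) * c := by
      have := mul_le_mul_of_nonneg_right (mul_le_mul hθH'le hA₁le hA₁ htH0) hc; linarith
    exact constH313_mono₄ hCL' hθH' hθH'le hA₁ hA₁le hA₃ hA₃le hB₃ (hBx β h0 h1) (le_max_right _ _) (hBx β h0 h1) (le_max_right _ _)
      zero_le_one h1κ hc
  have hCu0 : ∀ β, 0 ≤ β → β < 1 → 0 ≤ Cu β := fun β h0 h1 =>
    (constH313_nonneg (add_nonneg (hBh β h0 h1) (mul_nonneg (mul_nonneg hθH' hA₁) hc)) hθH' hA₁ hA₃ hB₃ (hBx β h0 h1) (hBx β h0 h1)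
      zero_le_one hc).trans (hCuR β h0 h1)
  -- the two (3.43) probe majorants of 𝔊, at the rate ρ₄
  have hL43 : ∀ β, 0 ≤ β → β < 1 → HasMajorantHom (g := toB6 g R₀ H₀) 𝔬.blk 𝔭.blkPY (𝔭.ΦY U β ∘ₗ (𝔬.D U ∘ₗ 𝔬.GG U))
      (fun (a b : g.Site) => Cu β * g.len a ^ (1 - β) * Real.exp (-(ρ₄ * g.dist a b))) := by
    intro β h0 h1
    have h := GG_probe43L_of_letters hG 𝔭 hrow hc hθ hθH' hB₀ hB₃ (hBh β h0 h1) (hBq β h0 h1) (hBhD β h0 h1) hσ hρ'.le hρ'ρ hρS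
      hρ₃ hρδ hq1 hK2 he0 (hH0.h43L β h0 h1) (hStH.pY1 β h0 h1) (hHH.pQ β h0 h1) (hH3.pYDH β h0 h1) hL hLD.rgdH hI
    exact hasMajorantHom_mono (g := toB6 g R₀ H₀) 𝔬.blk 𝔭.blkPY h fun a b =>
      mul_le_mul (mul_le_mul_of_nonneg_right (hCuL β h0 h1) (Real.rpow_nonneg (hlen a) _)) (hexp a b) (Real.exp_nonneg _)
        (mul_nonneg (hCu0 β h0 h1) (Real.rpow_nonneg (hlen a) _))
  have hR43 : ∀ β, 0 ≤ β → β < 1 → HasMajorantHom (g := toB6 g R₀ H₀) 𝔬.blkY 𝔭.blkPX (𝔭.ΦX U β ∘ₗ (𝔬.GG U ∘ₗ 𝔬.Dstar U))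
      (fun (a b : g.Site) => Cu β * g.len a ^ (1 - β) * Real.exp (-(ρ₄ * g.dist a b))) := by
    intro β h0 h1
    have h := GG_probe43R_of_letters hG 𝔭 hrow hc hθ hθH' hB₀ hB₃ (hBh β h0 h1) (hBx β h0 h1) hσ hρ'.le hρ'ρ hρS hρ₃ hρδ hq1
      hK1 he2 (hH0.h43R β h0 h1) (hStH.pX1 β h0 h1) (hH3.pXDv β h0 h1) (hH3.pXQs β h0 h1) hL hI
    exact hasMajorantHom_mono (g := toB6 g R₀ H₀) 𝔬.blkY 𝔭.blkPX h fun a b =>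
      mul_le_mul (mul_le_mul_of_nonneg_right (hCuR β h0 h1) (Real.rpow_nonneg (hlen a) _)) (hexp a b) (Real.exp_nonneg _)
        (mul_nonneg (hCu0 β h0 h1) (Real.rpow_nonneg (hlen a) _))
  -- the (3.44), (3.45) input majorants of 𝔊 at the rate ρ₄, constants uniformised
  have h44 : ∀ ε, 0 < ε → ε ≤ 1 → HasMaj (bHY ε) (BlockNorm.ofBlocks (toB6 g R₀ H₀) 𝔬.blkY) (𝔬.D U ∘ₗ (𝔬.GG U ∘ₗ 𝔬.Dstar U))
      (fun (a b : g.Site) => ((Bi ε + (B₀ + tD * (2 * B₀) * c) * Λu * tH * c) +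
        κu * (Bd ε + (B₀ + tD * (2 * B₀) * c) * Λu * tV * c) * Br * c +
        (B₃ + tD * (2 * B₃) * c) * Λu * (B₃ * (B₃ * (2 * B₀) * c) * c) * c) * Real.exp (-(ρ₄ * g.dist a b))) := by
    intro ε h0 h1
    have h := GG_input44_of_letters hG 𝔭 hrow hc hθ hθ' hθH' hθv' hB₀ hB₃ (hBi ε h0 h1) (hBd ε h0 h1) hBr hΛ0 hα0 hσ h0 h1
      hρ₄0 hρ₄r hρ'.le hρ'0 hρ'₃ hρ'K hq1 hST hK1 hK2 he0 he2 hLS (hH0.h44 ε h0 h1) (hStH.tD1 ε h0) hL hLD hLI hI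
    refine h.mono fun a b => mul_le_mul_of_nonneg_right ?_ (Real.exp_nonneg _)
    unfold constI44
    exact polyI44_le' (hBd ε h0 h1) hB₀ hB₃ hBr hc hA₁ hA₁le hA₃ hA₃le hθ' hθ'le hθH' hθH'le hθv' hθv'le hΛ0 hΛle
      (bHW ε).κ_nonneg (hκW ε)
  have h45 : ∀ ε β, 0 < ε → ε ≤ 1 → 0 ≤ β → β < 1 →
      HasMaj (bHY (β + ε)) (BlockNorm.ofBlocks (toB6 g R₀ H₀) 𝔭.blkPY) (𝔭.ΦY U β ∘ₗ (𝔬.D U ∘ₗ (𝔬.GG U ∘ₗ 𝔬.Dstar U)))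
      (fun (a b : g.Site) => ((Bi2 ε β + (Bh β + tH * (2 * B₀) * c) * Λu * tH * c) +
        κu * (Bd2 ε β + (Bh β + tH * (2 * B₀) * c) * Λu * tV * c) * Br * c +
        (Bq β + tH * (2 * B₃) * c) * Λu * (B₃ * (B₃ * (2 * B₀) * c) * c) * c) * g.len a ^ (-β) *
        Real.exp (-(ρ₄ * g.dist a b))) := by
    intro ε β h0 h1 hb0 hb1
    have hε' : 0 < β + ε := by linarith
    have h := GG_input45_of_letters hG 𝔭 hrow hc hθ hθH' hθv' hB₀ hB₃ (hBh β hb0 hb1) (hBi2 ε β h0 h1 hb0 hb1) (hBq β hb0 hb1)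
      (hBd2 ε β h0 h1 hb0 hb1) hBr hΛ0 hα0 hσ h0 h1 hb0 hb1 hρ₄0 hρ₄r hρ'.le hρ'0 hρ'₃ hρ'K hq1 hST hK1 hK2 he0 he2
      (hH0.h43L β hb0 hb1) (hStH.pY1 β hb0 hb1) (hHH.pQ β hb0 hb1) (hH0.h45 ε β h0 h1 hb0 hb1) (hStH.tD1 (β + ε) hε') hL hLI hI
    refine h.mono fun a b => mul_le_mul_of_nonneg_right (mul_le_mul_of_nonneg_right ?_ (Real.rpow_nonneg (hG.lenle a) _))
      (Real.exp_nonneg _)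
    unfold constI45
    exact polyI45_le' (hBd2 ε β h0 h1 hb0 hb1) (hBh β hb0 hb1) (hBq β hb0 hb1) hB₃ hBr hc hA₁ hA₁le hA₃ hA₃le hθH' hθH'le hθv'
      hθv'le hΛ0 hΛle (bHW (β + ε)).κ_nonneg (hκW (β + ε)) hB₀
  have hU44 : ∀ ε, 0 < ε → ε ≤ 1 → 0 ≤ (Bi ε + (B₀ + tD * (2 * B₀) * c) * Λu * tH * c) +
      κu * (Bd ε + (B₀ + tD * (2 * B₀) * c) * Λu * tV * c) * Br * c +
      (B₃ + tD * (2 * B₃) * c) * Λu * (B₃ * (B₃ * (2 * B₀) * c) * c) * c := by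
    intro ε h0 h1
    have hBiε := hBi ε h0 h1
    have hBdε := hBd ε h0 h1
    positivity
  have hU45 : ∀ ε β, 0 < ε → ε ≤ 1 → 0 ≤ β → β < 1 → 0 ≤ (Bi2 ε β + (Bh β + tH * (2 * B₀) * c) * Λu * tH * c) +
      κu * (Bd2 ε β + (Bh β + tH * (2 * B₀) * c) * Λu * tV * c) * Br * c +
      (Bq β + tH * (2 * B₃) * c) * Λu * (B₃ * (B₃ * (2 * B₀) * c) * c) * c := by
    intro ε β h0 h1 hb0 hb1
    have hBi2ε := hBi2 ε β h0 h1 hb0 hb1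
    have hBd2ε := hBd2 ε β h0 h1 hb0 hb1
    have hBhβ := hBh β hb0 hb1
    have hBqβ := hBq β hb0 hb1
    positivity
  exact ineq343_345_of_majorants_nbr (R := R₀) (H := H₀) hG 𝔭 bHY hRd₂ hmult hCL1 hCL hCu0 hU44 hU45 hρ₄0 hL43 hR43 h44 h45 hH1 hIn

end OneMember

end

end Literature.MathematicalPhysics.QuantumFieldTheory.Balaban1983to89.B9Thm313WholeBlocksNbr
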